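import Mathlib.RingTheory.Kaehler.JacobiZariski
import Mathlib.RingTheory.Flat.Basic
import HarnessLib

/-!
# Jacobi–Zariski: injectivity of `T ⊗_S I/I² → J/J²` for composite presentations

Topic: `Literature/AlgebraicGeometry/Resolution` (commutative algebra serving the descent of
smoothness, `SmoothDescent.lean`, which discharges the form of The Stacks Project, Tag 05B5 used
in M. Temkin, *Inseparable local uniformization*, J. Algebra 373 (2013), proof of Thm. 4.1.1,
Step 4).

Setting (Mathlib's `Algebra.Generators` / `RingTheory/Kaehler/JacobiZariski.lean`): ring maps
`R → S → T`, a presentation `P : R[Y] → S` with kernel `I` and a presentation `Q : S[X] → T`;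
the composite presentation `Q.comp P : R[X, Y] → T` has kernel `J ⊇ I·R[X, Y]`. Mathlib proves
that `T ⊗_S I/I² → J/J² → K/K²` is exact (`Algebra.Generators.Cotangent.exact`) and the
resulting six-term Jacobi–Zariski sequence, but NOT the injectivity of the left-hand map, which
holds only under a Tor-type condition (module docstring of that file: "The flatness assumption
… is stronger than the `Tor`-vanishing conditions required in the full statement of
[Stacks 00S2]"). This file PROVES:

* `CotangentInjectivity.liftBaseChange_cotangent_injective` — `T ⊗_S I/I² → J/J²` is injective
  as soon as `I·R[X,Y] ∩ J² ⊆ I·R[X,Y]·J` (an ideal-theoretic avatar of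
  `Tor`-vanishing). Proof: `R[X, Y]` is free over `R[Y]`, so `R[X,Y] ⊗_{R[Y]} I ≅ I·R[X,Y]`
  (`mulMap`, injective by flatness); the evaluation `Θ₀ : R[X,Y] ⊗_{R[Y]} I → T ⊗_S I/I²`
  is surjective, the cotangent map sends `Θ₀ u` to the class of `mulMap u`, and `Θ₀` kills
  every `u` with `mulMap u ∈ I·R[X,Y]·J`.
* `CotangentInjectivity.liftBaseChange_h1Cotangent_injective`,
  `CotangentInjectivity.subsingleton_tensor_h1Cotangent` — hence, for `T` flat over `S`,
  `T ⊗_S H₁(L_P) → H₁(L_{Q.comp P})` is injective, and `T ⊗_S H₁(L_P) = 0` when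
  `H₁(L_{Q.comp P}) = 0`.

The ideal-theoretic condition is verified for kernels generated by a Koszul pair in
`SmoothDescentStandardEtale.lean` (standard étale algebras over polynomial rings).

## Sources

* The Stacks Project, Tag 00S2 (the Jacobi–Zariski sequence for naive cotangent complexes) and
  Tag 05B5 (the application); folklore homological algebra.

## Rendering notes

* Everything is phrased for Mathlib's `Algebra.Generators`, `Algebra.Extension.Cotangent`,
  `Extension.H1Cotangent`; the `R[Y]`-algebra structure of `R[X, Y]` (`algebraComp`, through
  `Generators.toComp`) and the facts `IsScalarTower`/`Module.Free` over it are LOCAL instances.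
-/

noncomputable section

open KaehlerDifferential Module TensorProduct

namespace Literature.AlgebraicGeometry.Resolution

namespace CotangentInjectivity

universe w₁ w₂ u₁ u₂ u₃

variable {R : Type u₁} {S : Type u₂} [CommRing R] [CommRing S] [Algebra R S]
variable {T : Type u₃} [CommRing T] [Algebra R T] [Algebra S T] [IsScalarTower R S T]
variable {ι : Type w₁} {σ : Type w₂}
variable (Q : Algebra.Generators S T ι) (P : Algebra.Generators R S σ)


-- The presentation rings `P.toExtension.Ring` are `P.Ring` only up to unfolding `toExtension`;
-- as in Mathlib's `RingTheory/Kaehler/JacobiZariski.lean` the following options let unification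
-- see through it.
set_option backward.isDefEq.respectTransparency false
set_option backward.defeqAttrib.useBackward true

open Algebra Algebra.Generators MvPolynomial

/-- The quotient map `I → I/I²` of the presentation `P`, typed over `P.Ring`. [folklore] -/
noncomputable def mkP : P.ker →ₗ[P.Ring] P.toExtension.Cotangent :=
  Extension.Cotangent.mk (P := P.toExtension)

/-- `mkP` is `Extension.Cotangent.mk`. [folklore] -/
lemma mkP_apply (i : P.ker) : mkP P i = Extension.Cotangent.mk (P := P.toExtension) i := rfl

/-- `I → I/I²` is surjective. [folklore] -/
lemma mkP_surjective : Function.Surjective (mkP P) :=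
  Extension.Cotangent.mk_surjective (P := P.toExtension)

/-- The class of `i` vanishes iff `i ∈ I²`. [folklore] -/
lemma mkP_eq_zero_iff (i : P.ker) : mkP P i = 0 ↔ (i : P.Ring) ∈ P.ker ^ 2 :=
  Extension.Cotangent.mk_eq_zero_iff (P := P.toExtension) i

/-- The composite presentation ring `R[X, Y]` is an algebra over `R[Y]` (the variables of `P`
are sent to the corresponding variables of `Q.comp P`). [folklore] -/
@[reducible] noncomputable def algebraComp : Algebra P.Ring (Q.comp P).Ring :=
  (Q.toComp P).toAlgHom.toRingHom.toAlgebra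

attribute [local instance] algebraComp

/-- The structure map `R[Y] → R[X, Y]` is `toComp`. [folklore] -/
lemma algebraMap_comp_apply (p : P.Ring) :
    algebraMap P.Ring (Q.comp P).Ring p = (Q.toComp P).toAlgHom p := rfl

/-- `R → R[Y] → R[X, Y]` is a scalar tower. [folklore] -/
theorem isScalarTower_comp : IsScalarTower R P.Ring (Q.comp P).Ring :=
  IsScalarTower.of_algebraMap_eq fun r => by
    rw [algebraMap_comp_apply, MvPolynomial.algebraMap_eq, MvPolynomial.algebraMap_eq]
    simp

attribute [local instance] isScalarTower_comp

/-- `R[X, Y]` is a free `R[Y]`-module (it is `R[Y][X]`, `MvPolynomial.sumAlgEquiv`). [folklore] -/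
theorem free_comp : Module.Free P.Ring (Q.comp P).Ring := by
  let e₀ : (Q.comp P).Ring ≃ₐ[R] MvPolynomial ι P.Ring := MvPolynomial.sumAlgEquiv R ι σ
  have he₀ : ∀ p : P.Ring, e₀ (algebraMap P.Ring (Q.comp P).Ring p) = C p := fun p => by
    rw [algebraMap_comp_apply, Generators.toComp_toAlgHom]
    exact congrArg (fun φ : MvPolynomial σ R →ₐ[R] MvPolynomial ι (MvPolynomial σ R) => φ p)
      (MvPolynomial.sumAlgEquiv_comp_rename_inr (R := R) (S₁ := ι) (S₂ := σ))
  let e : (Q.comp P).Ring ≃ₗ[P.Ring] MvPolynomial ι P.Ring :=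
    { e₀.toAddEquiv with
      map_smul' := fun p x => by
        change e₀ (p • x) = p • e₀ x
        rw [Algebra.smul_def, map_mul, he₀, Algebra.smul_def, MvPolynomial.algebraMap_eq] }
  exact Module.Free.of_equiv e.symm

attribute [local instance] free_comp

/-- The multiplication map `R[X,Y] ⊗_{R[Y]} I → R[X,Y]`, `c ⊗ i ↦ i c`, whose image is the
extended ideal `I·R[X,Y]`; injective since `R[X,Y]` is flat over `R[Y]`. [folklore] -/
noncomputable def mulMap : (Q.comp P).Ring ⊗[P.Ring] P.ker →ₗ[P.Ring] (Q.comp P).Ring :=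
  (TensorProduct.rid P.Ring (Q.comp P).Ring).toLinearMap ∘ₗ (P.ker.subtype).lTensor (Q.comp P).Ring

/-- `mulMap (c ⊗ i) = i·c`. [folklore] -/
@[simp] lemma mulMap_tmul (c : (Q.comp P).Ring) (i : P.ker) :
    mulMap Q P (c ⊗ₜ i) = (Q.toComp P).toAlgHom (i : P.Ring) * c := by
  simp [mulMap, Algebra.smul_def, algebraMap_comp_apply]

/-- `mulMap` is injective (flatness of `R[X,Y]` over `R[Y]`). [folklore] -/
lemma mulMap_injective : Function.Injective (mulMap Q P) := by
  unfold mulMap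
  simp only [LinearMap.coe_comp, LinearEquiv.coe_coe, EquivLike.comp_injective]
  exact Module.Flat.lTensor_preserves_injective_linearMap _ Subtype.val_injective

/-- `mulMap` is `R[X,Y]`-linear. [folklore] -/
lemma mulMap_smul (c : (Q.comp P).Ring) (u : (Q.comp P).Ring ⊗[P.Ring] P.ker) :
    mulMap Q P (c • u) = c * mulMap Q P u := by
  induction u using TensorProduct.induction_on with
  | zero => simp
  | tmul x y => rw [smul_tmul', mulMap_tmul, mulMap_tmul, smul_eq_mul]; ring
  | add x y hx hy => rw [smul_add, map_add, map_add, hx, hy, mul_add]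

/-- Every element of the extended ideal `I·R[X,Y]` is in the image of `mulMap`. [folklore] -/
lemma exists_mulMap_eq_of_mem {a : (Q.comp P).Ring}
    (ha : a ∈ P.ker.map (Q.toComp P).toAlgHom) :
    ∃ u, mulMap Q P u = a := by
  refine Submodule.span_induction (p := fun a _ => ∃ u, mulMap Q P u = a) ?_ ?_ ?_ ?_ ha
  · rintro _ ⟨i, hi, rfl⟩
    exact ⟨1 ⊗ₜ ⟨i, hi⟩, by simp⟩
  · exact ⟨0, by simp⟩
  · rintro x y - - ⟨u, rfl⟩ ⟨v, rfl⟩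
    exact ⟨u + v, by simp⟩
  · rintro c x - ⟨u, rfl⟩
    exact ⟨c • u, by rw [mulMap_smul, smul_eq_mul]⟩

/-- The image of `mulMap` lies in the extended ideal `I·R[X,Y]`. [folklore] -/
lemma mulMap_mem (u : (Q.comp P).Ring ⊗[P.Ring] P.ker) :
    mulMap Q P u ∈ P.ker.map (Q.toComp P).toAlgHom := by
  induction u using TensorProduct.induction_on with
  | zero => simp
  | tmul x y =>
    rw [mulMap_tmul]
    exact Ideal.mul_mem_right _ _ (Ideal.mem_map_of_mem _ y.2)
  | add x y hx hy => rw [map_add]; exact Ideal.add_mem _ hx hy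

/-- `I·R[X,Y] ⊆ J`. [folklore] -/
lemma map_toComp_le_ker : P.ker.map (Q.toComp P).toAlgHom ≤ (Q.comp P).ker := by
  rw [Generators.map_toComp_ker]
  intro x hx
  rw [RingHom.mem_ker] at hx
  change x ∈ RingHom.ker (algebraMap (Q.comp P).Ring T)
  rw [RingHom.mem_ker, Generators.algebraMap_apply]
  have := (Q.ofComp P).algebraMap_toAlgHom x
  rw [hx, map_zero, Algebra.algebraMap_self, RingHom.id_apply] at this
  exact this.symm

/-- The image of `mulMap` lies in `J`. [folklore] -/
lemma mulMap_mem_ker (u : (Q.comp P).Ring ⊗[P.Ring] P.ker) : mulMap Q P u ∈ (Q.comp P).ker :=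
  map_toComp_le_ker Q P (mulMap_mem Q P u)

/-- The quotient map `J → J/J²` of the composite presentation, typed over `(Q.comp P).Ring`.
[folklore] -/
noncomputable def mkQP : (Q.comp P).ker →ₗ[(Q.comp P).Ring] (Q.comp P).toExtension.Cotangent :=
  Extension.Cotangent.mk (P := (Q.comp P).toExtension)

/-- The class of `j` in `J/J²` vanishes iff `j ∈ J²`. [folklore] -/
lemma mkQP_eq_zero_iff (j : (Q.comp P).ker) :
    mkQP Q P j = 0 ↔ (j : (Q.comp P).Ring) ∈ (Q.comp P).ker ^ 2 :=
  Extension.Cotangent.mk_eq_zero_iff (P := (Q.comp P).toExtension) j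

/-- The class of `mulMap u` in `J/J²`. [folklore] -/
noncomputable def mulClass (u : (Q.comp P).Ring ⊗[P.Ring] P.ker) :
    (Q.comp P).toExtension.Cotangent :=
  mkQP Q P ⟨mulMap Q P u, mulMap_mem_ker Q P u⟩

/-- `mulClass` is additive. [folklore] -/
lemma mulClass_add (u v : (Q.comp P).Ring ⊗[P.Ring] P.ker) :
    mulClass Q P (u + v) = mulClass Q P u + mulClass Q P v := by
  unfold mulClass
  rw [← map_add]
  congr 1
  exact Subtype.ext (map_add _ _ _)

/-- `mulClass 0 = 0`. [folklore] -/
lemma mulClass_zero : mulClass Q P 0 = 0 := by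
  unfold mulClass
  convert (mkQP Q P).map_zero
  exact map_zero _

/-- The cotangent map of `toComp` on classes: `[i] ↦ [toComp i]`. [folklore] -/
lemma map_mkP (i : P.ker) :
    Extension.Cotangent.map (Q.toComp P).toExtensionHom (mkP P i) =
      mkQP Q P ⟨(Q.toComp P).toAlgHom i, map_toComp_le_ker Q P (Ideal.mem_map_of_mem _ i.2)⟩ :=
  Extension.Cotangent.map_mk (Q.toComp P).toExtensionHom _

/-- The algebra map `R[X,Y] → T` on the image of `R[Y]` factors through `S`. [folklore] -/
lemma algebraMap_toComp (p : P.Ring) :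
    algebraMap (Q.comp P).Ring T ((Q.toComp P).toAlgHom p) = algebraMap S T (algebraMap P.Ring S p) := by
  rw [Generators.algebraMap_apply, Generators.algebraMap_apply, (Q.toComp P).algebraMap_toAlgHom]

/-- The evaluation `Θ₀ : R[X,Y] ⊗_{R[Y]} I → T ⊗_S I/I²`, `c ⊗ i ↦ c̄ ⊗ [i]`. [folklore] -/
noncomputable def theta : (Q.comp P).Ring ⊗[P.Ring] P.ker →+ T ⊗[S] P.toExtension.Cotangent := by
  letI : Module P.Ring (T ⊗[S] P.toExtension.Cotangent) :=
    Module.compHom _ ((algebraMap S T).comp (algebraMap P.Ring S))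
  refine (TensorProduct.lift (LinearMap.mk₂ P.Ring
    (fun (c : (Q.comp P).Ring) (i : P.ker) => algebraMap (Q.comp P).Ring T c ⊗ₜ[S] mkP P i)
    ?_ ?_ ?_ ?_)).toAddMonoidHom
  · intro c₁ c₂ i
    rw [map_add, add_tmul]
  · intro p c i
    change algebraMap _ T (p • c) ⊗ₜ[S] _ =
      ((algebraMap S T) (algebraMap P.Ring S p)) • (algebraMap _ T c ⊗ₜ[S] _)
    rw [Algebra.smul_def, map_mul, algebraMap_comp_apply, algebraMap_toComp, smul_tmul',
      smul_eq_mul]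
  · intro c i₁ i₂
    rw [(mkP P).map_add, tmul_add]
  · intro p c i
    change _ ⊗ₜ[S] mkP P (p • i) =
      ((algebraMap S T) (algebraMap P.Ring S p)) • (algebraMap _ T c ⊗ₜ[S] _)
    rw [(mkP P).map_smul]
    change _ ⊗ₜ[S] ((algebraMap P.Ring S p) • mkP P i) = _
    rw [← smul_tmul, smul_tmul', Algebra.smul_def, smul_eq_mul]

/-- `Θ₀ (c ⊗ i) = c̄ ⊗ [i]`. [folklore] -/
lemma theta_tmul (c : (Q.comp P).Ring) (i : P.ker) :
    theta Q P (c ⊗ₜ i) = algebraMap (Q.comp P).Ring T c ⊗ₜ[S] mkP P i := by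
  simp [theta]

/-- `Θ₀` is semilinear over `R[X,Y] → T`. [folklore] -/
lemma theta_smul (c : (Q.comp P).Ring) (u : (Q.comp P).Ring ⊗[P.Ring] P.ker) :
    theta Q P (c • u) = algebraMap (Q.comp P).Ring T c • theta Q P u := by
  induction u using TensorProduct.induction_on with
  | zero => simp
  | tmul x y => rw [smul_tmul', theta_tmul, theta_tmul, smul_eq_mul, map_mul, smul_tmul', smul_eq_mul]
  | add x y hx hy => rw [smul_add, map_add, map_add, hx, hy, smul_add]

/-- `Θ₀` is surjective. [folklore] -/
lemma theta_surjective : Function.Surjective (theta Q P) := by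
  intro ξ
  induction ξ using TensorProduct.induction_on with
  | zero => exact ⟨0, map_zero _⟩
  | tmul t x =>
    obtain ⟨c, rfl⟩ := (Q.comp P).algebraMap_surjective t
    obtain ⟨i, rfl⟩ := mkP_surjective P x
    exact ⟨c ⊗ₜ i, theta_tmul Q P c i⟩
  | add x y hx hy =>
    obtain ⟨u, rfl⟩ := hx
    obtain ⟨v, rfl⟩ := hy
    exact ⟨u + v, map_add _ _ _⟩

/-- `β ∘ Θ₀ = [mulMap]`: the base-changed cotangent map sends `Θ₀ u` to the class of
`mulMap u` in `J/J²`. [folklore] -/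
lemma liftBaseChange_theta (u : (Q.comp P).Ring ⊗[P.Ring] P.ker) :
    (Extension.Cotangent.map (Q.toComp P).toExtensionHom).liftBaseChange T (theta Q P u) =
      mulClass Q P u := by
  induction u using TensorProduct.induction_on with
  | zero => rw [map_zero, map_zero, mulClass_zero]
  | tmul c i =>
    rw [theta_tmul, LinearMap.liftBaseChange_tmul, map_mkP, algebraMap_smul,
      ← (mkQP Q P).map_smul]
    unfold mulClass
    congr 1
    apply Subtype.ext
    change c * (Q.toComp P).toAlgHom (i : P.Ring) = mulMap Q P (c ⊗ₜ i)
    rw [mulMap_tmul, mul_comm]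
  | add x y hx hy =>
    rw [map_add, map_add, hx, hy, mulClass_add]

/-- **Injectivity of `T ⊗_S I/I² → J/J²` from the ideal-theoretic condition
`I·R[X,Y] ∩ J² ⊆ I·R[X,Y]·J`.** [folklore] -/
theorem liftBaseChange_cotangent_injective
    (hKOS : P.ker.map (Q.toComp P).toAlgHom ⊓ (Q.comp P).ker ^ 2 ≤
      P.ker.map (Q.toComp P).toAlgHom * (Q.comp P).ker) :
    Function.Injective ((Extension.Cotangent.map (Q.toComp P).toExtensionHom).liftBaseChange T) := by
  set 𝔞 := P.ker.map (Q.toComp P).toAlgHom with h𝔞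
  rw [injective_iff_map_eq_zero]
  intro ξ hξ
  obtain ⟨u, rfl⟩ := theta_surjective Q P ξ
  rw [liftBaseChange_theta] at hξ
  unfold mulClass at hξ
  rw [mkQP_eq_zero_iff] at hξ
  have hmem : mulMap Q P u ∈ 𝔞 * (Q.comp P).ker := hKOS ⟨mulMap_mem Q P u, hξ⟩
  -- every `v` with `mulMap v ∈ 𝔞 J` has `Θ₀ v = 0`
  suffices key : ∀ x (hx : x ∈ 𝔞 * (Q.comp P).ker), ∀ v, mulMap Q P v = x → theta Q P v = 0 from
    key _ hmem u rfl
  intro x hx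
  refine Submodule.smul_induction_on' (p := fun x _ => ∀ v, mulMap Q P v = x → theta Q P v = 0)
    hx ?_ ?_
  · intro a ha j hj v hv
    obtain ⟨w, rfl⟩ := exists_mulMap_eq_of_mem Q P ha
    have : v = j • w := by
      apply mulMap_injective Q P
      rw [hv, mulMap_smul, smul_eq_mul, mul_comm]
    rw [this, theta_smul]
    have hj0 : algebraMap (Q.comp P).Ring T j = 0 := hj
    rw [hj0, zero_smul]
  · intro x hx y hy hpx hpy v hv
    obtain ⟨wx, rfl⟩ := exists_mulMap_eq_of_mem Q P (Ideal.mul_le_right hx)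
    obtain ⟨wy, rfl⟩ := exists_mulMap_eq_of_mem Q P (Ideal.mul_le_right hy)
    have : v = wx + wy := by
      apply mulMap_injective Q P
      rw [hv, map_add]
    rw [this, map_add, hpx wx rfl, hpy wy rfl, add_zero]


/-! ### From the conormal level to `H¹` -/

/-- The base-changed map on `H¹` is injective as soon as the one on conormal modules is, for
`T` flat over `S`. [folklore] -/
theorem liftBaseChange_h1Cotangent_injective [Module.Flat S T]
    (hKOS : P.ker.map (Q.toComp P).toAlgHom ⊓ (Q.comp P).ker ^ 2 ≤
      P.ker.map (Q.toComp P).toAlgHom * (Q.comp P).ker) :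
    Function.Injective
      ((Extension.H1Cotangent.map (Q.toComp P).toExtensionHom).liftBaseChange T) := by
  have hsq : ∀ z : T ⊗[S] P.toExtension.H1Cotangent,
      (Q.comp P).toExtension.h1Cotangentι
        ((Extension.H1Cotangent.map (Q.toComp P).toExtensionHom).liftBaseChange T z) =
      (Extension.Cotangent.map (Q.toComp P).toExtensionHom).liftBaseChange T
        ((P.toExtension.h1Cotangentι).lTensor T z) := by
    intro z
    induction z using TensorProduct.induction_on with
    | zero => simp
    | tmul t h =>
      simp only [LinearMap.liftBaseChange_tmul, LinearMap.lTensor_tmul, map_smul,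
        Extension.h1Cotangentι_apply, Extension.H1Cotangent.map_apply_coe]
    | add x y hx hy => simp only [map_add, hx, hy]
  intro z₁ z₂ h
  apply Module.Flat.lTensor_preserves_injective_linearMap (M := T) P.toExtension.h1Cotangentι
    Extension.h1Cotangentι_injective
  apply liftBaseChange_cotangent_injective Q P hKOS
  rw [← hsq, ← hsq, h]

/-- If moreover `H¹` of the composite presentation vanishes, so does `T ⊗_S H¹(P)`.
[folklore] -/
theorem subsingleton_tensor_h1Cotangent [Module.Flat S T]
    (hKOS : P.ker.map (Q.toComp P).toAlgHom ⊓ (Q.comp P).ker ^ 2 ≤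
      P.ker.map (Q.toComp P).toAlgHom * (Q.comp P).ker)
    [Subsingleton (Q.comp P).toExtension.H1Cotangent] :
    Subsingleton (T ⊗[S] P.toExtension.H1Cotangent) :=
  (liftBaseChange_h1Cotangent_injective Q P hKOS).subsingleton

end CotangentInjectivity

end Literature.AlgebraicGeometry.Resolution
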